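import Literature.AnabelianGeometry.SemiGraphs.PSCGraphicTransport

/-!
# [CombGC] Proposition 1.5 (ii) ⇐ over the interface, I: transport of the vertex / node / cusp classes

Mochizuki, *A combinatorial version of the Grothendieck conjecture*, Tohoku Math. J. **59** (2007)
[CombGC], §1, Proposition 1.5 (ii), author's manuscript p. 13: "`α` is graphic if and only if it is
group-theoretically edge-like and group-theoretically verticial."  The implication "⇒" is
`PSCGraphicProofs.lean` (seat abc-iut-L3-t4) and the uniqueness clause is `PSCGraphicTransport.lean`;
this proof-only companion (abc-iut cell, wave-4 seat abc-iut-w4-d081, at abc-iut-L3-lead's invitation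
2026-08-25T23:21:16Z) begins the REDUCTION of the converse "⇐" — the combinatorial heart of the
criterion for graphicity (Theorem 1.6 (ii), p. 13, whose proof p. 14 ends "… so `α` is
group-theoretically edge-like and verticial, hence graphic by Proposition 1.5, (ii)") — to the
conclusions of Proposition 1.2 (i) (`VerticialOpenInterDeterminesVertex`,
`EdgeLikeOpenInterDeterminesEdge`) and Proposition 1.5 (i) (`EdgeLikeIncidence`) for the two data
`G`, `H`, exactly as the printed proof of Prop. 1.5 (ii) does ("the vertices of `G` are the conjugacy
classes of verticial subgroups, the edges the conjugacy classes of edge-like subgroups, an edge is a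
cusp iff it lies in one verticial subgroup [(i)] …", p. 13).

This file, for EVERY pair of data `G : PSCDatum Π`, `H : PSCDatum Π'` and every `α : Π ≃ₜ* Π'`:

* Prop. 1.2 (i) read as SEPARATION: coinciding conjugates `γ₁ Π_{v₁} = γ₂ Π_{v₂}` force `v₁ = v₂`
  (`eq_of_smul_vertGp_eq`), likewise for edges (`eq_of_smul_edgeGp_eq`); hence nodal subgroups are
  not cuspidal (`not_isCuspidal_of_isNodal`);
* for a group-theoretically verticial `α` the verticial overgroups of `E ≤ Π_G` and of `α(E) ≤ Π_H`
  correspond (`existsUnique_isVerticial_ge_iff_map`), so by Prop. 1.5 (i) for `G` and `H` a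
  group-theoretically edge-like `α` carries CUSPIDAL subgroups to cuspidal ones and NODAL ones to
  nodal ones, and all of them arise (`isCuspidal_iff_isCuspidal_map`, `isNodal_map_nodeGp`,
  `exists_smul_nodeGp_map_eq`, `exists_smul_cuspGp_map_eq`);
* the generic reconstruction step (`exists_equiv_of_conj_classes`): if `α` carries the conjugacy
  class of each `S v` into the class of some `T w` and every class of a `T w` is hit, and the
  classes separate indices on both sides, then `v ↦ w` is a BIJECTION `ιV ≃ ιW` — applied to
  vertices, nodes and cusps this yields the three bijections of the isomorphism of underlying
  semi-graphs (`exists_vertEquiv`, `exists_nodeEquiv`, `exists_cuspEquiv`).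

The incidence relations (`cuspEnd`, `nodeEnds`) and the assembly of `IsGraphic` are in the sequel
`PSCGraphicConverseIncidence.lean`.  Pure proofs, no definitions, no new named facts; the printed
Propositions 1.2 (i) / 1.5 (i) enter BY NAME as hypotheses (they are theorems about data of
geometric origin and are not provable over the interface, cf. the module docstring of
`PSCGraphicity.lean`).  Nothing here takes a side on [IUTchIII] Cor. 3.12.
-/

noncomputable section

namespace Literature.AnabelianGeometry.SemiGraphs

namespace PSCDatum

open scoped Pointwise

universe u

variable {P : Type u} [Group P] [TopologicalSpace P]
variable {P' : Type u} [Group P'] [TopologicalSpace P']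

/-! ### Proposition 1.2 (i) as separation of conjugacy classes -/

section Separation

variable {G : PSCDatum P}

/-- **[CombGC] Prop. 1.2 (i)**, verticial case, in the form used by the proof of Prop. 1.5 (ii):
conjugates of `Π_{v₁}` and `Π_{v₂}` that coincide come from the same vertex (their intersection is
all of `γ₁ Π_{v₁}`, in particular open in it). [cite: MochizukiCombGC2007, Prop 1.2(i) p.8] -/
theorem eq_of_smul_vertGp_eq (hV : G.VerticialOpenInterDeterminesVertex) {v₁ v₂ : G.graph.V}
    {γ₁ γ₂ : ConjAct P} (h : γ₁ • G.vertGp v₁ = γ₂ • G.vertGp v₂) : v₁ = v₂ :=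
  hV v₁ v₂ γ₁ γ₂ (isOpen_subgroupOf_inf_of_eq h)

/-- **[CombGC] Prop. 1.2 (i)**, edge-like case: coinciding conjugates of `Π_{e₁}`, `Π_{e₂}` (nodes
or cusps) come from the same edge. [cite: MochizukiCombGC2007, Prop 1.2(i) p.8] -/
theorem eq_of_smul_edgeGp_eq (hE : G.EdgeLikeOpenInterDeterminesEdge)
    {e₁ e₂ : G.graph.N ⊕ G.graph.C} {γ₁ γ₂ : ConjAct P}
    (h : γ₁ • G.edgeGp e₁ = γ₂ • G.edgeGp e₂) : e₁ = e₂ :=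
  hE e₁ e₂ γ₁ γ₂ (isOpen_subgroupOf_inf_of_eq h)

/-- Prop. 1.2 (i) for nodes: `γ₁ Π_{e₁} = γ₂ Π_{e₂}` forces `e₁ = e₂`.
[cite: MochizukiCombGC2007, Prop 1.2(i) p.8] -/
theorem eq_of_smul_nodeGp_eq (hE : G.EdgeLikeOpenInterDeterminesEdge) {e₁ e₂ : G.graph.N}
    {γ₁ γ₂ : ConjAct P} (h : γ₁ • G.nodeGp e₁ = γ₂ • G.nodeGp e₂) : e₁ = e₂ :=
  Sum.inl_injective (eq_of_smul_edgeGp_eq hE (e₁ := Sum.inl e₁) (e₂ := Sum.inl e₂) h)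

/-- Prop. 1.2 (i) for cusps: `γ₁ Π_{c₁} = γ₂ Π_{c₂}` forces `c₁ = c₂`.
[cite: MochizukiCombGC2007, Prop 1.2(i) p.8] -/
theorem eq_of_smul_cuspGp_eq (hE : G.EdgeLikeOpenInterDeterminesEdge) {c₁ c₂ : G.graph.C}
    {γ₁ γ₂ : ConjAct P} (h : γ₁ • G.cuspGp c₁ = γ₂ • G.cuspGp c₂) : c₁ = c₂ :=
  Sum.inr_injective (eq_of_smul_edgeGp_eq hE (e₁ := Sum.inr c₁) (e₂ := Sum.inr c₂) h)

/-- Under Prop. 1.2 (i) a nodal subgroup is not cuspidal (a closed edge is not an open edge).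
[cite: MochizukiCombGC2007, Prop 1.2(i) p.8] -/
theorem not_isCuspidal_of_isNodal (hE : G.EdgeLikeOpenInterDeterminesEdge) {A : Subgroup P}
    (hA : G.IsNodal A) : ¬ G.IsCuspidal A := by
  rintro ⟨c, γ, rfl⟩
  obtain ⟨e, δ, h⟩ := hA
  exact Sum.inr_ne_inl (eq_of_smul_edgeGp_eq hE (e₁ := Sum.inr c) (e₂ := Sum.inl e) h)

end Separation

/-! ### Transport along `α` -/

section Transport

variable {G : PSCDatum P} {H : PSCDatum P'} {α : P ≃ₜ* P'}

/-- `Subgroup.map` along the isomorphism `α` is injective. [folklore] -/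
private theorem map_equiv_injective (α : P ≃ₜ* P') :
    Function.Injective (Subgroup.map α.toMulEquiv.toMonoidHom : Subgroup P → Subgroup P') :=
  Subgroup.map_injective α.toMulEquiv.injective

/-- `Subgroup.map` along `α` reflects inclusions. [folklore] -/
private theorem map_equiv_le_iff (α : P ≃ₜ* P') {S T : Subgroup P} :
    S.map α.toMulEquiv.toMonoidHom ≤ T.map α.toMulEquiv.toMonoidHom ↔ S ≤ T :=
  Subgroup.map_le_map_iff_of_injective α.toMulEquiv.injective

/-- Conjugating an image is the image of a conjugate: `δ · α(S) = α(α⁻¹(δ) · S)`.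
[cite: MochizukiCombGC2007, Def 1.4(i) p.10] -/
theorem smul_map_eq_map_smul (δ : ConjAct P') (S : Subgroup P) :
    δ • S.map α.toMulEquiv.toMonoidHom =
      (ConjAct.toConjAct (α.symm (ConjAct.ofConjAct δ)) • S).map α.toMulEquiv.toMonoidHom := by
  rw [map_conj_smul, ConjAct.ofConjAct_toConjAct]
  have hα : α.toMulEquiv.toMonoidHom (α.symm (ConjAct.ofConjAct δ)) = ConjAct.ofConjAct δ :=
    α.apply_symm_apply _
  rw [hα, ConjAct.toConjAct_ofConjAct]

/-- For a group-theoretically verticial `α`, `A` is verticial iff `α(A)` is (the "moreover, every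
verticial subgroup arises" clause read backwards through the injectivity of `α` on subgroups).
[cite: MochizukiCombGC2007, Def 1.4(iv) p.11] -/
theorem isVerticial_iff_isVerticial_map (hv : G.IsGroupTheoreticallyVerticial H α) (A : Subgroup P) :
    G.IsVerticial A ↔ H.IsVerticial (A.map α.toMulEquiv.toMonoidHom) := by
  refine ⟨hv.1 A, fun hA => ?_⟩
  obtain ⟨A', hA', h⟩ := hv.2 _ hA
  rwa [← map_equiv_injective α h]

/-- For a group-theoretically edge-like `α`, `A` is edge-like iff `α(A)` is.
[cite: MochizukiCombGC2007, Def 1.4(iv) p.11] -/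
theorem isEdgeLike_iff_isEdgeLike_map (he : G.IsGroupTheoreticallyEdgeLike H α) (A : Subgroup P) :
    G.IsEdgeLike A ↔ H.IsEdgeLike (A.map α.toMulEquiv.toMonoidHom) := by
  refine ⟨he.1 A, fun hA => ?_⟩
  obtain ⟨A', hA', h⟩ := he.2 _ hA
  rwa [← map_equiv_injective α h]

/-- A group-theoretically verticial `α` matches the verticial overgroups of `E ≤ Π_G` with those
of `α(E) ≤ Π_H`; in particular "contained in precisely one verticial subgroup" is transported.
[cite: MochizukiCombGC2007, Prop 1.5(i) p.12] -/
theorem existsUnique_isVerticial_ge_iff_map (hv : G.IsGroupTheoreticallyVerticial H α)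
    (E : Subgroup P) :
    (∃! A : Subgroup P, G.IsVerticial A ∧ E ≤ A) ↔
      ∃! B : Subgroup P', H.IsVerticial B ∧ E.map α.toMulEquiv.toMonoidHom ≤ B := by
  constructor
  · rintro ⟨A, ⟨hA, hEA⟩, huniq⟩
    refine ⟨A.map α.toMulEquiv.toMonoidHom, ⟨hv.1 A hA, Subgroup.map_mono hEA⟩, ?_⟩
    rintro B ⟨hB, hEB⟩
    obtain ⟨A', hA', rfl⟩ := hv.2 B hB
    rw [huniq A' ⟨hA', (map_equiv_le_iff α).1 hEB⟩]
  · rintro ⟨B, ⟨hB, hEB⟩, huniq⟩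
    obtain ⟨A, hA, rfl⟩ := hv.2 B hB
    refine ⟨A, ⟨hA, (map_equiv_le_iff α).1 hEB⟩, ?_⟩
    rintro A' ⟨hA', hEA'⟩
    exact map_equiv_injective α (huniq _ ⟨hv.1 A' hA', Subgroup.map_mono hEA'⟩)

/-- **Cusps go to cusps.**  For `α` group-theoretically verticial and edge-like, and `G`, `H`
satisfying the conclusion of Prop. 1.5 (i), an edge-like `E ≤ Π_G` is cuspidal iff `α(E)` is
cuspidal (both "⇔ contained in precisely one verticial subgroup").
[cite: MochizukiCombGC2007, Prop 1.5(ii) p.13] -/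
theorem isCuspidal_iff_isCuspidal_map (hv : G.IsGroupTheoreticallyVerticial H α)
    (he : G.IsGroupTheoreticallyEdgeLike H α) (hIG : G.EdgeLikeIncidence) (hIH : H.EdgeLikeIncidence)
    {E : Subgroup P} (hE : G.IsEdgeLike E) :
    G.IsCuspidal E ↔ H.IsCuspidal (E.map α.toMulEquiv.toMonoidHom) := by
  rw [(hIG E hE).1, (hIH _ (he.1 E hE)).1]
  exact existsUnique_isVerticial_ge_iff_map hv E

/-- `α(Π_c)` is a cuspidal subgroup of `Π_H`. [cite: MochizukiCombGC2007, Prop 1.5(ii) p.13] -/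
theorem isCuspidal_map_cuspGp (hv : G.IsGroupTheoreticallyVerticial H α)
    (he : G.IsGroupTheoreticallyEdgeLike H α) (hIG : G.EdgeLikeIncidence) (hIH : H.EdgeLikeIncidence)
    (c : G.graph.C) : H.IsCuspidal ((G.cuspGp c).map α.toMulEquiv.toMonoidHom) :=
  (isCuspidal_iff_isCuspidal_map hv he hIG hIH (Or.inr ⟨c, 1, (one_smul _ _).symm⟩)).1
    ⟨c, 1, (one_smul _ _).symm⟩

/-- **Nodes go to nodes**: `α(Π_e)` is a nodal subgroup of `Π_H` (it is edge-like, and were it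
cuspidal, `Π_e` would be cuspidal, contradicting Prop. 1.2 (i) for `G`).
[cite: MochizukiCombGC2007, Prop 1.5(ii) p.13] -/
theorem isNodal_map_nodeGp (hEG : G.EdgeLikeOpenInterDeterminesEdge)
    (hv : G.IsGroupTheoreticallyVerticial H α) (he : G.IsGroupTheoreticallyEdgeLike H α)
    (hIG : G.EdgeLikeIncidence) (hIH : H.EdgeLikeIncidence) (e : G.graph.N) :
    H.IsNodal ((G.nodeGp e).map α.toMulEquiv.toMonoidHom) := by
  have hEd : G.IsEdgeLike (G.nodeGp e) := Or.inl ⟨e, 1, (one_smul _ _).symm⟩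
  rcases he.1 _ hEd with hn | hc
  · exact hn
  · exact absurd ((isCuspidal_iff_isCuspidal_map hv he hIG hIH hEd).2 hc)
      (not_isCuspidal_of_isNodal hEG ⟨e, 1, (one_smul _ _).symm⟩)

/-- Every `Π_{e'}` (`e'` a node of `H`) is the image of a conjugate of some `Π_e`, `e` a node of `G`.
[cite: MochizukiCombGC2007, Prop 1.5(ii) p.13] -/
theorem exists_smul_nodeGp_map_eq (hEH : H.EdgeLikeOpenInterDeterminesEdge)
    (hv : G.IsGroupTheoreticallyVerticial H α) (he : G.IsGroupTheoreticallyEdgeLike H α)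
    (hIG : G.EdgeLikeIncidence) (hIH : H.EdgeLikeIncidence) (e' : H.graph.N) :
    ∃ (e : G.graph.N) (γ : ConjAct P),
      (γ • G.nodeGp e).map α.toMulEquiv.toMonoidHom = H.nodeGp e' := by
  obtain ⟨A, hA, hAB⟩ := he.2 (H.nodeGp e') (Or.inl ⟨e', 1, (one_smul _ _).symm⟩)
  rcases hA with ⟨e, γ, rfl⟩ | hc
  · exact ⟨e, γ, hAB⟩
  · exfalso
    have h : H.IsCuspidal (A.map α.toMulEquiv.toMonoidHom) :=
      (isCuspidal_iff_isCuspidal_map hv he hIG hIH (Or.inr hc)).1 hc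
    rw [hAB] at h
    exact not_isCuspidal_of_isNodal hEH ⟨e', 1, (one_smul _ _).symm⟩ h

/-- Every `Π_{c'}` (`c'` a cusp of `H`) is the image of a conjugate of some `Π_c`, `c` a cusp of `G`.
[cite: MochizukiCombGC2007, Prop 1.5(ii) p.13] -/
theorem exists_smul_cuspGp_map_eq (hv : G.IsGroupTheoreticallyVerticial H α)
    (he : G.IsGroupTheoreticallyEdgeLike H α) (hIG : G.EdgeLikeIncidence) (hIH : H.EdgeLikeIncidence)
    (c' : H.graph.C) :
    ∃ (c : G.graph.C) (γ : ConjAct P),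
      (γ • G.cuspGp c).map α.toMulEquiv.toMonoidHom = H.cuspGp c' := by
  obtain ⟨A, hA, hAB⟩ := he.2 (H.cuspGp c') (Or.inr ⟨c', 1, (one_smul _ _).symm⟩)
  have hc : H.IsCuspidal (A.map α.toMulEquiv.toMonoidHom) := by
    rw [hAB]
    exact ⟨c', 1, (one_smul _ _).symm⟩
  obtain ⟨c, γ, rfl⟩ := (isCuspidal_iff_isCuspidal_map hv he hIG hIH hA).2 hc
  exact ⟨c, γ, hAB⟩

end Transport

/-! ### The reconstruction step: classes matched by `α` give a bijection of indices -/

section Reconstruction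

variable {α : P ≃ₜ* P'}

/-- **The reconstruction step of the proof of Prop. 1.5 (ii)** (p. 13: the vertices resp. edges of
`G` "are" the conjugacy classes of verticial resp. edge-like subgroups of `Π_G`).  If `α` carries
the class of each `S v` into the class of some `T w`, every class of a `T w` is hit by the class of
some `S v`, and on both sides distinct indices have distinct classes (Prop. 1.2 (i)), then the
assignment `v ↦ w` is a bijection `φ : ιV ≃ ιW` with `α(S v)` conjugate to `T (φ v)`.
[cite: MochizukiCombGC2007, Prop 1.5(ii) p.13] -/
theorem exists_equiv_of_conj_classes {ιV ιW : Type} (S : ιV → Subgroup P) (T : ιW → Subgroup P')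
    (hS : ∀ (v₁ v₂ : ιV) (γ₁ γ₂ : ConjAct P), γ₁ • S v₁ = γ₂ • S v₂ → v₁ = v₂)
    (hT : ∀ (w₁ w₂ : ιW) (γ₁ γ₂ : ConjAct P'), γ₁ • T w₁ = γ₂ • T w₂ → w₁ = w₂)
    (h₁ : ∀ v, ∃ (w : ιW) (γ : ConjAct P'), (S v).map α.toMulEquiv.toMonoidHom = γ • T w)
    (h₂ : ∀ w, ∃ (v : ιV) (γ : ConjAct P), (γ • S v).map α.toMulEquiv.toMonoidHom = T w) :
    ∃ φ : ιV ≃ ιW, ∀ v, ∃ γ : ConjAct P', (S v).map α.toMulEquiv.toMonoidHom = γ • T (φ v) := by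
  choose φ γ hφ using h₁
  have hT' : ∀ v, T (φ v) = (γ v)⁻¹ • (S v).map α.toMulEquiv.toMonoidHom := fun v => by
    rw [hφ v, inv_smul_smul]
  have hinj : Function.Injective φ := by
    intro v₁ v₂ h
    have h₂' : (S v₂).map α.toMulEquiv.toMonoidHom =
        (γ v₂ * (γ v₁)⁻¹) • (S v₁).map α.toMulEquiv.toMonoidHom := by
      rw [mul_smul, ← hT' v₁, h, ← hφ v₂]
    rw [smul_map_eq_map_smul] at h₂'
    have h₃ := map_equiv_injective α h₂'
    exact (hS v₂ v₁ 1 _ (by rw [one_smul]; exact h₃)).symm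
  have hsurj : Function.Surjective φ := by
    intro w
    obtain ⟨v, δ, hδ⟩ := h₂ w
    refine ⟨v, ?_⟩
    rw [map_conj_smul, hφ v, smul_smul] at hδ
    exact (hT _ _ _ 1 (hδ.trans (one_smul _ _).symm))
  exact ⟨Equiv.ofBijective φ ⟨hinj, hsurj⟩, fun v => ⟨γ v, hφ v⟩⟩

variable {G : PSCDatum P} {H : PSCDatum P'}

/-- **Vertices**: for a group-theoretically verticial `α`, and `G`, `H` satisfying the verticial
case of Prop. 1.2 (i), `α` induces a bijection `V(𝔾) ≃ V(ℍ)` carrying the class of `Π_v` to that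
of `Π_{φ v}`. [cite: MochizukiCombGC2007, Prop 1.5(ii) p.13] -/
theorem exists_vertEquiv (hVG : G.VerticialOpenInterDeterminesVertex)
    (hVH : H.VerticialOpenInterDeterminesVertex) (hv : G.IsGroupTheoreticallyVerticial H α) :
    ∃ φ : G.graph.V ≃ H.graph.V,
      ∀ v, ∃ γ : ConjAct P', (G.vertGp v).map α.toMulEquiv.toMonoidHom = γ • H.vertGp (φ v) := by
  refine exists_equiv_of_conj_classes G.vertGp H.vertGp
    (fun _ _ _ _ h => eq_of_smul_vertGp_eq hVG h) (fun _ _ _ _ h => eq_of_smul_vertGp_eq hVH h)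
    (fun v => hv.1 _ ⟨v, 1, (one_smul _ _).symm⟩) fun w => ?_
  obtain ⟨A, ⟨v, γ, rfl⟩, hA⟩ := hv.2 _ ⟨w, 1, (one_smul _ _).symm⟩
  exact ⟨v, γ, hA⟩

/-- **Nodes**: for `α` group-theoretically verticial and edge-like, and `G`, `H` satisfying
Prop. 1.2 (i) (edge-like case) and Prop. 1.5 (i), `α` induces a bijection `N(𝔾) ≃ N(ℍ)` carrying
the class of `Π_e` to that of `Π_{χ e}`. [cite: MochizukiCombGC2007, Prop 1.5(ii) p.13] -/
theorem exists_nodeEquiv (hEG : G.EdgeLikeOpenInterDeterminesEdge)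
    (hEH : H.EdgeLikeOpenInterDeterminesEdge) (hv : G.IsGroupTheoreticallyVerticial H α)
    (he : G.IsGroupTheoreticallyEdgeLike H α) (hIG : G.EdgeLikeIncidence)
    (hIH : H.EdgeLikeIncidence) :
    ∃ χ : G.graph.N ≃ H.graph.N,
      ∀ e, ∃ γ : ConjAct P', (G.nodeGp e).map α.toMulEquiv.toMonoidHom = γ • H.nodeGp (χ e) :=
  exists_equiv_of_conj_classes G.nodeGp H.nodeGp
    (fun _ _ _ _ h => eq_of_smul_nodeGp_eq hEG h) (fun _ _ _ _ h => eq_of_smul_nodeGp_eq hEH h)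
    (fun e => isNodal_map_nodeGp hEG hv he hIG hIH e)
    (fun e' => exists_smul_nodeGp_map_eq hEH hv he hIG hIH e')

/-- **Cusps**: under the same hypotheses `α` induces a bijection `C(𝔾) ≃ C(ℍ)` carrying the class
of `Π_c` to that of `Π_{ψ c}`. [cite: MochizukiCombGC2007, Prop 1.5(ii) p.13] -/
theorem exists_cuspEquiv (hEG : G.EdgeLikeOpenInterDeterminesEdge)
    (hEH : H.EdgeLikeOpenInterDeterminesEdge) (hv : G.IsGroupTheoreticallyVerticial H α)
    (he : G.IsGroupTheoreticallyEdgeLike H α) (hIG : G.EdgeLikeIncidence)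
    (hIH : H.EdgeLikeIncidence) :
    ∃ ψ : G.graph.C ≃ H.graph.C,
      ∀ c, ∃ γ : ConjAct P', (G.cuspGp c).map α.toMulEquiv.toMonoidHom = γ • H.cuspGp (ψ c) :=
  exists_equiv_of_conj_classes G.cuspGp H.cuspGp
    (fun _ _ _ _ h => eq_of_smul_cuspGp_eq hEG h) (fun _ _ _ _ h => eq_of_smul_cuspGp_eq hEH h)
    (fun c => isCuspidal_map_cuspGp hv he hIG hIH c)
    (fun c' => exists_smul_cuspGp_map_eq hv he hIG hIH c')

end Reconstruction

end PSCDatum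

end Literature.AnabelianGeometry.SemiGraphs

end
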